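import Summits.QuantumFields.GaugeBoot.Eqs.BindKitZ
import HarnessLib

/-!
# Aggregated equality row of `beta-11857-5000-upper.conic1.json` — term piece 6/6 (data)

Cell `pub-gaugeboot` (HOME `run/shared/lean/pub/pub-gaugeboot/`), seat lean2 (KZ aggregated equality bindings; FANOUT-PLAN A126 (2)(c) /
A137 (1)(iii) / A146 / A152 (1)).  Certificate of record `certs/SU2-D4/kz-L2-rp/beta-11857-5000-upper.conic1.json` (sha256 field `6e30ff54e9ff95f5…`) over the
problem `certs/SU2-D4/kz-L2-rp/beta-11857-5000-upper.problem1.json` (`SU(2)`, `D = 4`, `β_std = 11857/5000`, 3300 equality rows, eng2's reduced form): its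
3300 exact equality multipliers `lamQ` (dyadic rationals; sha256 of the multiplier list `7e8045adff95a26f…`) contract the
equality rows into ONE row `r = Σ_e lamQ_e · row_e` (9983 labelled terms, right-hand side Σ_e lamQ_e · rhs_e = 0) — the only way
the certificate replay (lean3's `_of_feasible_agg` shape) uses the equality system.  The row is INTEGER-CODED (`Eqs/BindKitZ`: `(terms, M, K,
witness)`, terms `tz <label code> <z>` with coefficient `z / M` exactly, witness `lz <m> <def id> <position>` = an exact combination of
3300 of the family's G1 theorem rows `KZL2rpD4LitsZ*.litZ`, `μ = Σ_e lamQ_e · Λ_e` from the seat's exact elimination witnesses `Λ`,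
re-verified exactly in the seat).  Because of its size the row is spread over several modules: term pieces `…Z11857o5000UT<k>` and the
witness pieces `…Z11857o5000UW<k>` and the assembly `…Z11857o5000UR` (data only), and the final module `Eqs/KZL2rpD4Z11857o5000U` with the `m = 7` residue-class
kernel checks `chk<i>` (`Eqs/BindKitZPF.cchkZPf litZ p q 7 i` — the `BindKitZP` residue-class check with the class filter inside the combination; integer arithmetic only, one `decide` each, ≈ 21 s measured) and `Ecode`, `E_holds`, `rowSum4_row` (
`rowSum4 11857/5000 L r = 0` on every torus `(ℤ/L)^4` with `L ≥ 6`).  Positivity blocks and the certificate inequalities are NOT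
treated here.  GENERATED by `scratch/agg_data.py` + `scratch/gen_aggZP.py`.

HONEST FRAMING (page 1 of every file of this cell): certified bounds on lattice expectations at STATED coupling, gauge
group, dimension and torus size; NOT a mass gap, NOT a continuum limit, NOT a string tension, NOT large `N`; NOT
Yang–Mills-summit-bearing (barriers `FixedCouplingUltralocality`, `PerturbativeInvisibility`).
-/

noncomputable section

open Literature.MathematicalPhysics.QuantumFieldTheory
open Summit.QuantumFields.GaugeBoot.BindN Summit.QuantumFields.GaugeBoot.BindZ

namespace Summit.QuantumFields.GaugeBoot.KZL2rpD4.Z11857o5000U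

variable {L : ℕ} [NeZero L]

set_option maxRecDepth 100000 in
/-- Terms 9966–9982 of the coded aggregated row (`tz <label code> <z>`, coefficient `z / M`, `M` in `…Z11857o5000UR`). -/
def terms6 : List (ℕ × ℤ) := [
  tz 131523142646758625 1550241124217435352377527200000000000000000, tz 131523142645241326 (-46158748889247696938243880960000000000000000), tz 131523142645264536 164094826266233980432723673010000000000000000, tz 131523142645261526 (-90801251011934522560928520000000000000000), tz 131523142645261728 3978604065666610320153403950000000000000000, tz 131523142645267586 12496542425507781620360308350000000000000000, tz 131523142645271826 6052966093726218945393144210000000000000000, tz 131523142645768526 7428331971611621477349990480000000000000000, tz 131523142647281625 3111159902311232841863185740000000000000000, tz 131523142647281526 (-4278600836295430784467452120000000000000000), tz 131523142647685728 (-1427732336239321616122429260000000000000000), tz 131523142647586728 1135514591891684553606114690000000000000000, tz 131527182645264536 1804315677324416358146753580000000000000000,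
  tz 131527182645268576 576240255156856102783699307400000000000000000, tz 131527182645267586 277878219508359969212062171530000000000000000, tz 131527182645281726 132275613807315653519513640960000000000000000, tz 131527182645271826 (-70248104187999126136912097280000000000000000)]

end Summit.QuantumFields.GaugeBoot.KZL2rpD4.Z11857o5000U

end
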